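import Summits.Schanuel.Schanuel.Theorems.RootDecomp1JKhovanskiiBlocks
import Summits.Schanuel.Schanuel.Theorems.RootDecomp1DFlagSplit
import Literature.Barriers.Schanuel.LargeTranscendenceDegree

/-!
# Hereditary blocks, block hulls, curve hulls — the base spaces of route `RootDecomp1J`'s items G₂ / K₃

Definitions file supporting `stmt-Schanuel-30523` (`SchanuelOverPairClosedFields`, K₃, the declared
residual of `route-Schanuel-RootDecomp1J` rev 3) and `stmt-Schanuel-30522` (`PairBlocksOverCurveClosedFields`,
G₂).  It gives NAMES to the literal clauses of those two items and proves their elementary API.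
Nothing here is conditional and nothing here proves Schanuel.

* `HBlock E w` — the tuple `w : Fin n → ℂ` is a **hereditary block** over the `ℚ`-subspace `E ≤ ℂ`: for
  a finite witness set `Y ⊂ E`, over EVERY finitely generated field `ℚ(T, e^T)` with `T ⊇ Y`, whenever
  all coordinates of `w` are `ℚ`-combinations of `T` and of a sub-tuple `w ∘ ρ` of length `k`, the
  configuration `(w, e^w)` has transcendence degree `≤ k` over `ℚ(T, e^T)`.  This is the clause
  `(∃ Y : Finset ℂ, …)` of the items' texts.
* `blockStep N E = E ⊔ span_ℚ {coordinates of hereditary blocks of size ≤ N over E}` (`E^{B≤N}`), the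
  lambda iterated in the items; `blockHull N E = ⨆ n, (blockStep N)^[n + 1] E` (`𝓚_N(E)`).
* `OnCurve E g` / `curveStep E = E ⊔ span_ℚ {g | OnCurve E g}` / `curveHull E = ⨆ n, curveStep^[n+1] E`
  — the curve clause of items K₁ = 29587 / K₂ = 29588 (`(g, e^g)` costs `≤ 1` over some `E`-field).
* `GapOn`, `BlockCrit`, `RelOnRank` — the predicates of the gap lemma / block criterion / rank kernel
  (`RootDecomp1JGapLemma`, `RootDecomp1JRankKernel`).

So the items' base spaces are, DEFINITIONALLY, `𝓚 = curveHull 𝓜` (`𝓜` the EL-span) and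
`𝓚₂ = blockHull 2 𝓚` (`RootDecomp1JRankKernel.pairHullLit_eq : 𝓚₂-literal = blockHull 2 𝓚-literal := rfl`).

Main facts: `mem_blockStep_of_hblock`; finite character `mem_blockHull_of_hblock`;
**`blockStep_blockHull : blockStep N (blockHull N E) = blockHull N E`** (the hull is `N`-block-closed — the
ONLY property of `𝓚₂` the gap lemma uses); `hblock_one_iff_onCurve` and **`blockStep_one : blockStep 1 E =
curveStep E`** (a `1`-block is a curve point), whence `blockStep_one_curveHull_le` (`𝓚` is `1`-block-closed).

Provenance: decomposition cell `decomp-schanuel`, lens 3, NODE v10 `PeriodFlagSplit.lean` §0/§6/§22/§23/§33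
(kernel-checked there, sha256 2f56573c…); ported verbatim; imports: the two landed 1J/1D support files and a
Literature barrier file (for `trdeg_mono`), no Theses file of another route directly. [folklore throughout]
-/

set_option linter.dupNamespace false

noncomputable section

open Complex IntermediateField
open Literature.Barriers.Schanuel (trdeg_mono)
open Summit.Schanuel.Schanuel.Theorems.RootDecomp1DFlagSplit (trdeg_adjoin_union_eq_add
  trdeg_adjoin_le_cardinalMk trdeg_gens_lt_aleph0 rel_iff_add disjoint_span_of_linearIndependent_mkQ
  schanuelOn_of_relOn)
open Summit.Schanuel.Schanuel.Theorems.RootDecomp1JKhovanskiiBlocks (mem_and_isAlgebraic_exp_of_mem_span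
  mem_and_isAlgebraic_exp_of_mem_span_set reltrdeg_le_of_isAlgebraic trdeg_witnessField_lt_aleph0)

namespace Summit.Schanuel.Schanuel.Theorems.RootDecomp1JBlockHulls

/-! ### Generic tools -/

set_option synthInstance.maxHeartbeats 400000 in
/-- Cost zero: generators algebraic over the base field. [folklore] -/
theorem reltrdeg_eq_zero_of_isAlgebraic (K : IntermediateField ℚ ℂ) (S : Set ℂ)
    (h : ∀ x ∈ S, IsAlgebraic K x) : Algebra.trdeg K (adjoin K S) = 0 := by
  haveI : Algebra.IsAlgebraic K (adjoin K S) :=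
    IntermediateField.isAlgebraic_adjoin fun x hx => (h x hx).isIntegral
  exact trdeg_eq_zero

/-- The witness field of a finite set grows with the set. [folklore] -/
theorem witnessField_mono {Y T : Finset ℂ} (h : Y ⊆ T) :
    adjoin ℚ ((↑Y : Set ℂ) ∪ cexp '' ↑Y) ≤ adjoin ℚ ((↑T : Set ℂ) ∪ cexp '' ↑T) :=
  adjoin.mono _ _ _ (Set.union_subset_union (Finset.coe_subset.mpr h)
    (Set.image_mono (Finset.coe_subset.mpr h)))

/-- For a `1`-tuple, `range w ∪ range (e^w) = {w 0, e^{w 0}}`. [folklore] -/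
theorem range_union_range_exp_fin_one (w : Fin 1 → ℂ) :
    Set.range w ∪ Set.range (cexp ∘ w) = ({w 0, cexp (w 0)} : Set ℂ) := by
  ext u
  simp only [Set.mem_union, Set.mem_range, Function.comp_apply, Set.mem_insert_iff,
    Set.mem_singleton_iff]
  constructor
  · rintro (⟨j, rfl⟩ | ⟨j, rfl⟩)
    · exact Or.inl (by rw [Subsingleton.elim j 0])
    · exact Or.inr (by rw [Subsingleton.elim j 0])
  · rintro (rfl | rfl)
    · exact Or.inl ⟨0, rfl⟩
    · exact Or.inr ⟨0, rfl⟩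

open Submodule in
/-- A finite-dimensional `ℚ`-subspace of `ℂ` has a basis: a linearly independent tuple in it
spanning it. [folklore] -/
theorem exists_fin_basis (W : Submodule ℚ ℂ) [FiniteDimensional ℚ W] :
    ∃ u : Fin (Module.finrank ℚ W) → ℂ, (∀ i, u i ∈ W) ∧ LinearIndependent ℚ u ∧
      span ℚ (Set.range u) = W := by
  let bW := Module.finBasis ℚ W
  refine ⟨fun i => (bW i : ℂ), fun i => (bW i).2,
    bW.linearIndependent.map' W.subtype W.ker_subtype, ?_⟩
  apply le_antisymm
  · exact span_le.mpr (Set.range_subset_iff.mpr fun i => (bW i).2)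
  · intro a ha
    have hb := bW.mem_span (⟨a, ha⟩ : W)
    have hmap := Submodule.mem_map_of_mem (f := W.subtype) hb
    rw [Submodule.map_span, ← Set.range_comp] at hmap
    exact hmap

/-- Inside `V`, a subspace `W ≤ V` has a complement `C ≤ V` (`W ⊔ C = V`, `W ⊓ C = ⊥`). [folklore] -/
theorem exists_compl_in {W V : Submodule ℚ ℂ} (hWV : W ≤ V) :
    ∃ C : Submodule ℚ ℂ, C ≤ V ∧ W ⊔ C = V ∧ Disjoint W C := by
  obtain ⟨C', hC'⟩ := W.exists_isCompl
  refine ⟨V ⊓ C', inf_le_left, ?_, hC'.disjoint.mono_right inf_le_right⟩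
  rw [inf_comm, ← sup_inf_assoc_of_le C' hWV, hC'.sup_eq_top, top_inf_eq]

/-- Finite character: a finite subset of a directed union of subspaces lies in one level. -/
theorem exists_level_of_finset_subset {F : ℕ → Submodule ℚ ℂ} (hF : Monotone F) (Y : Finset ℂ)
    (hY : (↑Y : Set ℂ) ⊆ ↑(⨆ n, F n)) : ∃ N, (↑Y : Set ℂ) ⊆ (F N : Set ℂ) := by
  classical
  have h : ∀ t : ↥Y, ∃ n, (t : ℂ) ∈ F n := fun t =>
    (Submodule.mem_iSup_of_directed _ hF.directed_le).mp (hY (Finset.mem_coe.mpr t.2))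
  choose n hn using h
  refine ⟨Finset.univ.sup n, fun t ht => ?_⟩
  exact hF (Finset.le_sup (Finset.mem_univ (⟨t, Finset.mem_coe.mp ht⟩ : ↥Y)))
    (hn ⟨t, Finset.mem_coe.mp ht⟩)

/-! ### Curve points, curve steps, curve hulls (items K₁ / K₂) -/

/-- `OnCurve E g`: the pair `(g, e^g)` costs at most ONE transcendence degree over some `E`-field
`ℚ(Y, e^Y)`, `Y ⊂ E` finite — `(g, e^g)` is a point over an `E`-field of a plane algebraic curve. -/
def OnCurve (E : Submodule ℚ ℂ) (g : ℂ) : Prop :=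
  ∃ Y : Finset ℂ, (↑Y : Set ℂ) ⊆ (E : Set ℂ) ∧
    Algebra.trdeg ↥(adjoin ℚ ((↑Y : Set ℂ) ∪ cexp '' ↑Y))
      ↥(adjoin ↥(adjoin ℚ ((↑Y : Set ℂ) ∪ cexp '' ↑Y)) ({g, cexp g} : Set ℂ)) ≤ 1

/-- The **curve step** `E^C = E + span_ℚ {g | OnCurve E g}`. -/
def curveStep (E : Submodule ℚ ℂ) : Submodule ℚ ℂ := E ⊔ Submodule.span ℚ {g : ℂ | OnCurve E g}
/-- `E ≤ curveStep E`. -/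
theorem le_curveStep (E : Submodule ℚ ℂ) : E ≤ curveStep E := le_sup_left
/-- `g ∈ curveStep E`. -/
theorem mem_curveStep_of_onCurve {E : Submodule ℚ ℂ} {g : ℂ} (h : OnCurve E g) : g ∈ curveStep E :=
  Submodule.mem_sup_right (Submodule.subset_span h)

/-- The curve hull of `E`: `⋃ₙ (E^C)^[n+1]`. -/
def curveHull (E : Submodule ℚ ℂ) : Submodule ℚ ℂ := ⨆ n : ℕ, curveStep^[n + 1] E
/-- `curveStep^[n] E ≤ curveStep^[n+1] E`. -/
theorem iterate_curveStep_le_succ (E : Submodule ℚ ℂ) (n : ℕ) :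
    curveStep^[n] E ≤ curveStep^[n + 1] E := by
  rw [Function.iterate_succ_apply']; exact le_curveStep _
/-- `Monotone fun n => curveStep^[n] E`. -/
theorem iterate_curveStep_monotone (E : Submodule ℚ ℂ) : Monotone fun n => curveStep^[n] E :=
  monotone_nat_of_le_succ (iterate_curveStep_le_succ E)
/-- `n ↦ curveStep^[n+1] E` is monotone. -/
theorem iterate_curveStep_succ_monotone (E : Submodule ℚ ℂ) :
    Monotone fun n => curveStep^[n + 1] E :=
  fun _ _ hab => iterate_curveStep_monotone E (Nat.succ_le_succ hab)
/-- `E ≤ curveStep^[n] E`. -/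
theorem le_iterate_curveStep (E : Submodule ℚ ℂ) (n : ℕ) : E ≤ curveStep^[n] E :=
  iterate_curveStep_monotone E (Nat.zero_le n)
/-- `curveStep^[n] E ≤ curveHull E`. -/
theorem iterate_curveStep_le_curveHull (E : Submodule ℚ ℂ) (n : ℕ) :
    curveStep^[n] E ≤ curveHull E :=
  (iterate_curveStep_le_succ E n).trans (le_iSup (fun n => curveStep^[n + 1] E) n)
/-- `E ≤ curveHull E`. -/
theorem le_curveHull (E : Submodule ℚ ℂ) : E ≤ curveHull E := iterate_curveStep_le_curveHull E 0

/-- A curve point over the hull has its witness set in one level, so it lies in the next level. -/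
theorem mem_curveHull_of_onCurve {E : Submodule ℚ ℂ} {g : ℂ} (hg : OnCurve (curveHull E) g) :
    g ∈ curveHull E := by
  obtain ⟨Y, hY, hcost⟩ := hg
  obtain ⟨N, hN⟩ := exists_level_of_finset_subset (F := fun n => curveStep^[n + 1] E)
    (iterate_curveStep_succ_monotone E) Y hY
  have hg' : g ∈ curveStep (curveStep^[N + 1] E) := mem_curveStep_of_onCurve ⟨Y, hN, hcost⟩
  rw [← Function.iterate_succ_apply' curveStep (N + 1) E] at hg'
  exact iterate_curveStep_le_curveHull E (N + 1 + 1) hg'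

/-- **The hull is CURVE-CLOSED:** `(curveHull E)^C = curveHull E`. -/
theorem curveStep_curveHull (E : Submodule ℚ ℂ) : curveStep (curveHull E) = curveHull E :=
  le_antisymm (sup_le le_rfl (Submodule.span_le.mpr fun _ hg => mem_curveHull_of_onCurve hg))
    (le_curveStep _)

/-! ### Hereditary blocks -/

/-- `HBlock E w`: the tuple `w : Fin n → ℂ` is a **hereditary block** over the `ℚ`-subspace `E`:
for some finite witness set `Y ⊂ E`, over EVERY finitely generated field `ℚ(T, e^T)` with `T ⊇ Y`,
whenever all coordinates of `w` are `ℚ`-combinations of `T` and of a sub-tuple `w ∘ ρ` of length `k`,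
the whole configuration `(w, e^w)` has transcendence degree `≤ k` over `ℚ(T, e^T)`. -/
def HBlock (E : Submodule ℚ ℂ) {n : ℕ} (w : Fin n → ℂ) : Prop :=
  ∃ Y : Finset ℂ, (↑Y : Set ℂ) ⊆ (E : Set ℂ) ∧
    ∀ T : Finset ℂ, Y ⊆ T → ∀ (k : ℕ) (ρ : Fin k → Fin n),
      (∀ j, w j ∈ Submodule.span ℚ ((↑T : Set ℂ) ∪ Set.range (w ∘ ρ))) →
      Algebra.trdeg ↥(adjoin ℚ ((↑T : Set ℂ) ∪ cexp '' ↑T))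
        ↥(adjoin ↥(adjoin ℚ ((↑T : Set ℂ) ∪ cexp '' ↑T)) (Set.range w ∪ Set.range (cexp ∘ w))) ≤ k
/-- hereditary blocks over `E` are hereditary blocks over every `E' ≥ E`. -/
theorem HBlock.mono {E E' : Submodule ℚ ℂ} (h : E ≤ E') {n : ℕ} {w : Fin n → ℂ} (hw : HBlock E w) :
    HBlock E' w := by
  obtain ⟨Y, hY, hB⟩ := hw
  exact ⟨Y, hY.trans (SetLike.coe_subset_coe.mpr h), hB⟩

/-- Re-indexing / PADDING a block along a surjection of index sets keeps it a block. -/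
theorem HBlock.comp_surjective {E : Submodule ℚ ℂ} {n n' : ℕ} {w : Fin n → ℂ} (hw : HBlock E w)
    {σ : Fin n' → Fin n} (hσ : Function.Surjective σ) : HBlock E (w ∘ σ) := by
  obtain ⟨Y, hY, hB⟩ := hw
  refine ⟨Y, hY, fun T hYT k ρ hspan => ?_⟩
  have hspan' : ∀ j, w j ∈ Submodule.span ℚ ((↑T : Set ℂ) ∪ Set.range (w ∘ (σ ∘ ρ))) := by
    intro j
    obtain ⟨j', rfl⟩ := hσ j
    exact hspan j'
  have h := hB T hYT k (σ ∘ ρ) hspan'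
  have e1 : Set.range (w ∘ σ) = Set.range w := hσ.range_comp w
  have e2 : Set.range (cexp ∘ (w ∘ σ)) = Set.range (cexp ∘ w) := hσ.range_comp (cexp ∘ w)
  rw [e1, e2]
  exact h

/-- **A `1`-block is exactly a curve point** (v6 `OnCurve`): `HBlock E w ↔ OnCurve E (w 0)`. -/
theorem hblock_one_iff_onCurve {E : Submodule ℚ ℂ} {w : Fin 1 → ℂ} : HBlock E w ↔ OnCurve E (w 0) := by
  classical
  constructor
  · rintro ⟨Y, hY, hB⟩
    refine ⟨Y, hY, ?_⟩
    have h := hB Y le_rfl 1 id (fun j => Submodule.subset_span (Or.inr ⟨j, rfl⟩))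
    rw [range_union_range_exp_fin_one] at h
    exact_mod_cast h
  · rintro ⟨Y, hY, hc⟩
    refine ⟨Y, hY, fun T hYT k ρ hspan => ?_⟩
    rw [range_union_range_exp_fin_one]
    rcases Nat.eq_zero_or_pos k with rfl | hk
    · -- no coordinate survives: `w 0 ∈ span_ℚ T`, so `(w 0, e^{w 0})` is algebraic over `ℚ(T, e^T)`
      have h0 : w 0 ∈ Submodule.span ℚ (↑T : Set ℂ) := by
        have h := hspan 0
        rwa [Set.range_eq_empty (w ∘ ρ), Set.union_empty] at h
      have key := mem_and_isAlgebraic_exp_of_mem_span_set h0 (adjoin ℚ ((↑T : Set ℂ) ∪ cexp '' ↑T)) le_rfl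
      have hz : Algebra.trdeg ↥(adjoin ℚ ((↑T : Set ℂ) ∪ cexp '' ↑T))
          ↥(adjoin ↥(adjoin ℚ ((↑T : Set ℂ) ∪ cexp '' ↑T)) ({w 0, cexp (w 0)} : Set ℂ)) = 0 := by
        refine reltrdeg_eq_zero_of_isAlgebraic _ _ ?_
        rintro u (rfl | hu)
        · exact isAlgebraic_algebraMap (⟨w 0, key.1⟩ : ↥(adjoin ℚ ((↑T : Set ℂ) ∪ cexp '' ↑T)))
        · rw [Set.mem_singleton_iff.mp hu]; exact key.2
      rw [hz]
      exact_mod_cast le_rfl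
    · exact ((Literature.NumberTheory.Transcendental.trdeg_adjoin_le_of_le (witnessField_mono hYT) _).trans
        hc).trans (by exact_mod_cast hk)

/-! ### Block steps `E^{B≤N}` and block hulls `𝓚_N(E)` (items G₂ / K₃) -/

/-- The **`N`-block step**: adjoin to `E` the coordinates of every hereditary block of size `≤ N`. -/
def blockStep (N : ℕ) (E : Submodule ℚ ℂ) : Submodule ℚ ℂ :=
  E ⊔ Submodule.span ℚ {x : ℂ | ∃ n : ℕ, n ≤ N ∧ ∃ w : Fin n → ℂ, HBlock E w ∧ x ∈ Set.range w}
/-- `E ≤ blockStep N E`. -/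
theorem le_blockStep (N : ℕ) (E : Submodule ℚ ℂ) : E ≤ blockStep N E := le_sup_left
/-- the coordinates of a hereditary block of size `≤ N` over `E` lie in `blockStep N E`. -/
theorem mem_blockStep_of_hblock {N : ℕ} {E : Submodule ℚ ℂ} {n : ℕ} {w : Fin n → ℂ} (hn : n ≤ N)
    (hw : HBlock E w) (j : Fin n) : w j ∈ blockStep N E :=
  Submodule.mem_sup_right (Submodule.subset_span ⟨n, hn, w, hw, ⟨j, rfl⟩⟩)
/-- `blockStep N E ≤ blockStep N E'`. -/
theorem blockStep_mono {N : ℕ} {E E' : Submodule ℚ ℂ} (h : E ≤ E') : blockStep N E ≤ blockStep N E' :=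
  sup_le_sup h (Submodule.span_mono fun _ ⟨n, hn, w, hw, hx⟩ => ⟨n, hn, w, hw.mono h, hx⟩)
/-- `Monotone (blockStep N)`. -/
theorem blockStep_monotone (N : ℕ) : Monotone (blockStep N) := fun _ _ h => blockStep_mono h

/-- Monotone in the size bound (blocks of size `≤ N` are blocks of size `≤ N'`). -/
theorem blockStep_mono_size {N N' : ℕ} (h : N ≤ N') (E : Submodule ℚ ℂ) :
    blockStep N E ≤ blockStep N' E :=
  sup_le_sup le_rfl (Submodule.span_mono fun _ ⟨n, hn, w, hw, hx⟩ => ⟨n, hn.trans h, w, hw, hx⟩)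

/-- **`E^{B≤1} = E^C`:** the `1`-block step is the v6 curve step. -/
theorem blockStep_one (E : Submodule ℚ ℂ) : blockStep 1 E = curveStep E := by
  refine le_antisymm (sup_le (le_curveStep E) (Submodule.span_le.mpr ?_))
    (sup_le (le_blockStep 1 E) (Submodule.span_le.mpr ?_))
  · rintro x ⟨n, hn, w, hw, ⟨j, rfl⟩⟩
    interval_cases n
    · exact j.elim0
    · rw [Subsingleton.elim j 0]
      exact mem_curveStep_of_onCurve (hblock_one_iff_onCurve.mp hw)
  · intro g hg
    exact mem_blockStep_of_hblock le_rfl ((hblock_one_iff_onCurve (w := fun _ : Fin 1 => g)).mpr hg) 0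

/-- The **`N`-block hull** `𝓚_N(E) = ⋃ₙ (E^{B≤N})^[n+1]`. -/
def blockHull (N : ℕ) (E : Submodule ℚ ℂ) : Submodule ℚ ℂ := ⨆ n : ℕ, (blockStep N)^[n + 1] E
/-- `(blockStep N)^[n] E ≤ (blockStep N)^[n+1] E`. -/
theorem iterate_blockStep_le_succ (N : ℕ) (E : Submodule ℚ ℂ) (n : ℕ) :
    (blockStep N)^[n] E ≤ (blockStep N)^[n + 1] E := by
  rw [Function.iterate_succ_apply']; exact le_blockStep N _
/-- `n ↦ (blockStep N)^[n] E` is monotone. -/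
theorem iterate_blockStep_monotone (N : ℕ) (E : Submodule ℚ ℂ) :
    Monotone fun n => (blockStep N)^[n] E :=
  monotone_nat_of_le_succ (iterate_blockStep_le_succ N E)
/-- `n ↦ (blockStep N)^[n+1] E` is monotone. -/
theorem iterate_blockStep_succ_monotone (N : ℕ) (E : Submodule ℚ ℂ) :
    Monotone fun n => (blockStep N)^[n + 1] E :=
  fun _ _ hab => iterate_blockStep_monotone N E (Nat.succ_le_succ hab)
/-- `(blockStep N)^[n] E ≤ blockHull N E`. -/
theorem iterate_blockStep_le_blockHull (N : ℕ) (E : Submodule ℚ ℂ) (n : ℕ) :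
    (blockStep N)^[n] E ≤ blockHull N E :=
  (iterate_blockStep_le_succ N E n).trans (le_iSup (fun n => (blockStep N)^[n + 1] E) n)
/-- `E ≤ blockHull N E`. -/
theorem le_blockHull (N : ℕ) (E : Submodule ℚ ℂ) : E ≤ blockHull N E := iterate_blockStep_le_blockHull N E 0
/-- `blockStep N E ≤ blockHull N E`. -/
theorem blockStep_le_blockHull (N : ℕ) (E : Submodule ℚ ℂ) : blockStep N E ≤ blockHull N E :=
  iterate_blockStep_le_blockHull N E 1
/-- `(blockStep N)^[n]` is monotone in `E`. -/
theorem iterate_blockStep_mono (N : ℕ) {E E' : Submodule ℚ ℂ} (h : E ≤ E') (n : ℕ) :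
    (blockStep N)^[n] E ≤ (blockStep N)^[n] E' :=
  (blockStep_monotone N).iterate n h
/-- `blockHull N E ≤ blockHull N E'`. -/
theorem blockHull_mono (N : ℕ) {E E' : Submodule ℚ ℂ} (h : E ≤ E') : blockHull N E ≤ blockHull N E' :=
  iSup_mono fun n => iterate_blockStep_mono N h (n + 1)
/-- `(blockStep N)^[n] E` is monotone in the size `N`. -/
theorem iterate_blockStep_mono_size {N N' : ℕ} (h : N ≤ N') (E : Submodule ℚ ℂ) :
    ∀ n, (blockStep N)^[n] E ≤ (blockStep N')^[n] E
  | 0 => le_rfl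
  | n + 1 => by
    rw [Function.iterate_succ_apply', Function.iterate_succ_apply']
    exact (blockStep_mono (iterate_blockStep_mono_size h E n)).trans (blockStep_mono_size h _)
/-- `blockHull N E ≤ blockHull N' E`. -/
theorem blockHull_mono_size {N N' : ℕ} (h : N ≤ N') (E : Submodule ℚ ℂ) : blockHull N E ≤ blockHull N' E :=
  iSup_mono fun n => iterate_blockStep_mono_size h E (n + 1)

/-- Finite character: a block over the hull has its witness set in one level, so its coordinates lie
in the next level. -/
theorem mem_blockHull_of_hblock {N : ℕ} {E : Submodule ℚ ℂ} {n : ℕ} {w : Fin n → ℂ} (hn : n ≤ N)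
    (hw : HBlock (blockHull N E) w) (j : Fin n) : w j ∈ blockHull N E := by
  obtain ⟨Y, hY, hB⟩ := hw
  obtain ⟨M, hM⟩ := exists_level_of_finset_subset (F := fun n => (blockStep N)^[n + 1] E)
    (iterate_blockStep_succ_monotone N E) Y hY
  have h1 : w j ∈ blockStep N ((blockStep N)^[M + 1] E) := mem_blockStep_of_hblock hn ⟨Y, hM, hB⟩ j
  rw [← Function.iterate_succ_apply' (blockStep N) (M + 1) E] at h1
  exact iterate_blockStep_le_blockHull N E (M + 1 + 1) h1

/-- **The hull is `N`-BLOCK-CLOSED:** `(𝓚_N E)^{B≤N} = 𝓚_N E`. -/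
theorem blockStep_blockHull (N : ℕ) (E : Submodule ℚ ℂ) : blockStep N (blockHull N E) = blockHull N E := by
  refine le_antisymm (sup_le le_rfl (Submodule.span_le.mpr ?_)) (le_blockStep N _)
  rintro x ⟨n, hn, w, hw, ⟨j, rfl⟩⟩
  exact mem_blockHull_of_hblock hn hw j

/-- Minimality: an `N`-block-closed subspace above `E` contains `𝓚_N E`. -/
theorem blockHull_le_of_blockStep_le (N : ℕ) {E F : Submodule ℚ ℂ} (hEF : E ≤ F)
    (hF : blockStep N F ≤ F) : blockHull N E ≤ F := by
  have h : ∀ n, (blockStep N)^[n] E ≤ F := fun n => by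
    induction n with
    | zero => exact hEF
    | succ n ih => rw [Function.iterate_succ_apply']; exact (blockStep_mono ih).trans hF
  exact iSup_le fun n => h (n + 1)
/-- `blockHull N' (blockHull N E) = blockHull N' E` for `N ≤ N'`. -/
theorem blockHull_blockHull_of_le {N N' : ℕ} (h : N ≤ N') (E : Submodule ℚ ℂ) :
    blockHull N' (blockHull N E) = blockHull N' E :=
  le_antisymm
    (blockHull_le_of_blockStep_le N' (blockHull_mono_size h E) (blockStep_blockHull N' E).le)
    (blockHull_mono N' (le_blockHull N E))
/-- `blockHull N (blockHull N E) = blockHull N E`. -/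
theorem blockHull_blockHull (N : ℕ) (E : Submodule ℚ ℂ) : blockHull N (blockHull N E) = blockHull N E :=
  blockHull_blockHull_of_le le_rfl E

/-- **The curve hull is `1`-block-closed:** `(curveHull E)^{B≤1} ≤ curveHull E`. -/
theorem blockStep_one_curveHull_le (E : Submodule ℚ ℂ) : blockStep 1 (curveHull E) ≤ curveHull E := by
  rw [blockStep_one]; exact (curveStep_curveHull E).le

/-! ### Predicates of the gap lemma, the block criterion and the rank kernel -/

/-- `GapOn E c`: over every `E`-field `ℚ(y, e^y)` (`y ⊂ E` finite), every `c`-tuple `ℚ`-free modulo `E`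
costs `≥ c + 1`. -/
def GapOn (E : Submodule ℚ ℂ) (c : ℕ) : Prop :=
  ∀ (k : ℕ) (y : Fin k → ℂ) (τ : Fin c → ℂ), (∀ i, y i ∈ E) → LinearIndependent ℚ (E.mkQ ∘ τ) →
    ((c + 1 : ℕ) : Cardinal) ≤ Algebra.trdeg ↥(adjoin ℚ (Set.range y ∪ Set.range (cexp ∘ y)))
      ↥(adjoin ↥(adjoin ℚ (Set.range y ∪ Set.range (cexp ∘ y))) (Set.range τ ∪ Set.range (cexp ∘ τ)))

/-- `BlockCrit E s`: over every `E`-field, a `ℚ`-free-modulo-`E` `s`-tuple of cost `≤ s` is a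
hereditary `s`-block over `E`. -/
def BlockCrit (E : Submodule ℚ ℂ) (s : ℕ) : Prop :=
  ∀ (k : ℕ) (y : Fin k → ℂ) (w : Fin s → ℂ), (∀ i, y i ∈ E) → LinearIndependent ℚ (E.mkQ ∘ w) →
    Algebra.trdeg ↥(adjoin ℚ (Set.range y ∪ Set.range (cexp ∘ y)))
      ↥(adjoin ↥(adjoin ℚ (Set.range y ∪ Set.range (cexp ∘ y))) (Set.range w ∪ Set.range (cexp ∘ w))) ≤
      (s : Cardinal) → HBlock E w

/-- `RelOnRank E E'' M`: every instance of `Rel(E''|E)` of rank `m ≤ M` holds. -/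
def RelOnRank (E E'' : Submodule ℚ ℂ) (M : ℕ) : Prop :=
  ∀ (k m : ℕ) (y : Fin k → ℂ) (z : Fin m → ℂ), m ≤ M → (∀ i, y i ∈ E) → (∀ j, z j ∈ E'') →
    LinearIndependent ℚ (E.mkQ ∘ z) →
    (m : Cardinal) ≤ Algebra.trdeg ↥(adjoin ℚ (Set.range y ∪ Set.range (cexp ∘ y)))
      ↥(adjoin ↥(adjoin ℚ (Set.range y ∪ Set.range (cexp ∘ y))) (Set.range z ∪ Set.range (cexp ∘ z)))
/-- `RelOnRank E E'' M'` implies `RelOnRank E E'' M` for `M ≤ M'`. -/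
theorem relOnRank_mono {E E'' : Submodule ℚ ℂ} {M M' : ℕ} (h : M ≤ M') (hR : RelOnRank E E'' M') :
    RelOnRank E E'' M := fun k m y z hm hy hz hli => hR k m y z (hm.trans h) hy hz hli

end Summit.Schanuel.Schanuel.Theorems.RootDecomp1JBlockHulls

end
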